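import Literature.Analysis.PDE.SchauderInteriorBallHolderAux
import Literature.Analysis.FunctionSpaces.ContDiffHolderNormTwo
import HarnessLib

/-!
# The interior Schauder estimate on concentric balls for `C^{2,α}` functions

Topic `Literature/Analysis/PDE`. Gilbarg–Trudinger 2001, Cor. 6.3 (with Thm. 6.2) in the
interior form on concentric balls `B(x₀, ρ) ⊂ B(x₀, R)` for pure second-order operators
`P v = ∑ᵢⱼ aⁱʲ D²v(eᵢ, eⱼ)`, in the classical a-priori form for GENUINELY `C^{2,α}` functions:
there is `C = C(n, α, λ, Λ, K_a, ρ, R)` with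

  `sup_{B_ρ} |D²v| + [D²v]_{α; B_ρ} ≤ C · B`

whenever `v ∈ C²(B_R)` has an `α`-Hölder second derivative on `B_R` (with SOME constant `H`,
which does not enter the bound), `|P v|, [P v]_α, |v|, |Dv|, [Dv]_α ≤ B` on `B_R`, and the
coefficients are symmetric, `λ`-`Λ`-elliptic, bounded and `α`-Hölder (constant `K_a`) on `B_R`.

The tree's `Literature.Analysis.PDE.exists_schauder_interior_ball` is the same statement for
`v ∈ C^∞(B_R)`; the present version is the one needed in the regularity theory, where it is
applied to difference quotients of a `C^{2,α}` solution (which are only `C^{2,α}`). The proof is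
the same: multiply `v` by a smooth cut-off `χ` equal to `1` near `B̄(x₀, r₁)` and supported in
`B(x₀, r₂)`, `ρ < r₁ < r₂ < R`; the product `u = χ v` is `C²` with compact support in
`B̄(x₀, r₂)` and its second derivative is globally `α`-Hölder (this is where the hypothesis on
`[D²v]_α` enters, qualitatively), so `u ∈ C^{2,α}_b` and the tree's compact-support estimate
`Literature.Analysis.FunctionSpaces.exists_schauder_compact_support` applies to it; all the data
of `u` entering that estimate are bounded by a fixed multiple (depending on `χ` only) of `B`, and
on `B(x₀, ρ)` the second derivatives of `u` and `v` agree. The `C²` cut-off calculus is in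
`Literature/Analysis/PDE/SchauderInteriorBallHolderAux`.

* `exists_schauder_interior_ball_of_holder` — the estimate.

Everything is proved; no named facts.

## References

* D. Gilbarg, N. S. Trudinger, *Elliptic Partial Differential Equations of Second Order* (2001),
  Thm. 6.2, Cor. 6.3. [GilbargTrudinger2001]
-/

noncomputable section

open Filter Function Metric Set
open scoped NNReal ContDiff Topology
open Literature.Analysis.FunctionSpaces

namespace Literature.Analysis.PDE

/-! ### The estimate -/

variable {ι : Type*} [Fintype ι] [DecidableEq ι] {E : Type} [NormedAddCommGroup E]
  [InnerProductSpace ℝ E] [FiniteDimensional ℝ E] [MeasurableSpace E] [BorelSpace E] [Nontrivial E]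

/-- **Interior Schauder estimate on concentric balls for `C^{2,α}` functions**
(Gilbarg–Trudinger 2001, Cor. 6.3 for `b = c = 0`, a-priori form): for `0 < α < 1`, ellipticity
`0 < λ ≤ Λ`, a Hölder bound `K_a` of the coefficients and radii `0 < ρ < R` there is `C` such
that for all symmetric `λ`-`Λ`-elliptic coefficients `aⁱʲ` with `|aⁱʲ| ≤ K_a`,
`[aⁱʲ]_{α;B_R} ≤ K_a` on the ball `B_R = B(x₀, R)` and every `v ∈ C²(B_R)` whose second
derivative is `α`-Hölder on `B_R` (with some constant `H`, NOT entering the bound) solving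
`∑ aⁱʲ D²v(eᵢ,eⱼ) = f` on `B_R` with `|f|, [f]_α, |v|, |Dv|, [Dv]_α ≤ B` on `B_R`:
`|D²v| ≤ C·B` on `B_ρ` and `[D²v]_{α;B_ρ} ≤ C·B`. [cite: GilbargTrudinger2001, Cor. 6.3] -/
theorem exists_schauder_interior_ball_of_holder (bE : OrthonormalBasis ι ℝ E) {α : ℝ≥0}
    (hα0 : 0 < α) (hα1 : α < 1) {l : ℝ} (hl : 0 < l) (L : ℝ) (Ka : ℝ≥0) (x₀ : E) {ρ R : ℝ}
    (hρ : 0 < ρ) (hρR : ρ < R) :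
    ∃ C : ℝ≥0, ∀ (a : ι → ι → E → ℝ),
      (∀ i j x, a i j x = a j i x) →
      (∀ x ∈ ball x₀ R, ∀ ξ : ι → ℝ, l * ∑ i, ξ i ^ 2 ≤ ∑ i, ∑ j, a i j x * ξ i * ξ j) →
      (∀ x ∈ ball x₀ R, ∀ ξ : ι → ℝ, ∑ i, ∑ j, a i j x * ξ i * ξ j ≤ L * ∑ i, ξ i ^ 2) →
      (∀ i j, ∀ x ∈ ball x₀ R, ‖a i j x‖ ≤ Ka) →
      (∀ i j, HolderOnWith Ka α (a i j) (ball x₀ R)) →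
      ∀ (v f : E → ℝ) (B H : ℝ≥0), ContDiffOn ℝ 2 v (ball x₀ R) →
        HolderOnWith H α (iteratedFDeriv ℝ 2 v) (ball x₀ R) →
        (∀ x ∈ ball x₀ R, (∑ i, ∑ j, a i j x * iteratedFDeriv ℝ 2 v x ![bE i, bE j]) = f x) →
        (∀ x ∈ ball x₀ R, ‖f x‖ ≤ B) → HolderOnWith B α f (ball x₀ R) →
        (∀ x ∈ ball x₀ R, ‖v x‖ ≤ B) → (∀ x ∈ ball x₀ R, ‖fderiv ℝ v x‖ ≤ B) →
        HolderOnWith B α (fderiv ℝ v) (ball x₀ R) →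
        (∀ x ∈ ball x₀ ρ, ‖iteratedFDeriv ℝ 2 v x‖ ≤ C * B) ∧
          HolderOnWith (C * B) α (iteratedFDeriv ℝ 2 v) (ball x₀ ρ) := by
  have hα1' : α ≤ 1 := hα1.le
  have hR : 0 < R := hρ.trans hρR
  -- Step 1: radii `ρ < r₁ < r₂ < R` and the cut-off `χ` (`= 1` near `B̄_{r₁}`, `supp ⊆ B_{r₂}`)
  obtain ⟨r₁, hρr₁, hr₁R⟩ := exists_between hρR
  obtain ⟨r₂, hr₁r₂, hr₂R⟩ := exists_between hr₁R
  have hK : IsCompact (closedBall x₀ r₂) := isCompact_closedBall x₀ r₂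
  have hKR : closedBall x₀ r₂ ⊆ ball x₀ R := closedBall_subset_ball hr₂R
  obtain ⟨χ, hχ, hχc, hχU, hχ1, -⟩ := exists_contDiff_one_nhdsSet_of_isCompact
    (isCompact_closedBall x₀ r₁) isOpen_ball (closedBall_subset_ball hr₁r₂)
  have hχK : tsupport χ ⊆ closedBall x₀ r₂ := hχU.trans ball_subset_closedBall
  have hχR : tsupport χ ⊆ ball x₀ R := hχK.trans hKR
  -- Step 2: bounds and Hölder constants of `χ`, `∂χ`, `∂²χ`
  have h3top : ((3 : ℕ) : WithTop ℕ∞) ≤ ((⊤ : ℕ∞) : WithTop ℕ∞) := WithTop.coe_le_coe.mpr le_top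
  have hχ3 : ContDiff ℝ 3 χ := hχ.of_le (by exact_mod_cast h3top)
  have hχ2 : ContDiff ℝ 2 χ := hχ3.of_le (by norm_num)
  have hDχ : ∀ l', ContDiff ℝ 1 (fun x => fderiv ℝ χ x (bE l')) ∧
      HasCompactSupport (fun x => fderiv ℝ χ x (bE l')) := fun l' =>
    ⟨(hχ2.fderiv_right (m := 1) (by norm_num)).clm_apply contDiff_const,
      hχc.fderiv_apply (𝕜 := ℝ) (bE l')⟩
  have hD2χ : ∀ i j, ContDiff ℝ 1 (fun x => iteratedFDeriv ℝ 2 χ x ![bE i, bE j]) ∧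
      HasCompactSupport (fun x => iteratedFDeriv ℝ 2 χ x ![bE i, bE j]) := fun i j => by
    have heq : (fun x => iteratedFDeriv ℝ 2 χ x ![bE i, bE j]) =
        fun x => fderiv ℝ (fun y => fderiv ℝ χ y (bE j)) x (bE i) :=
      funext fun x => (fderiv_fderiv_apply_eq_iteratedFDeriv_two_real hχ2 (bE i) (bE j) x).symm
    rw [heq]
    exact ⟨(((hχ3.fderiv_right (m := 2) (by norm_num)).clm_apply
      contDiff_const).fderiv_right (m := 1) (by norm_num)).clm_apply contDiff_const,
      (hχc.fderiv_apply (𝕜 := ℝ) (bE j)).fderiv_apply (𝕜 := ℝ) (bE i)⟩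
  obtain ⟨Z0s, Z0h, hZ0⟩ :=
    exists_bound_holderWith_of_hasCompactSupport (hχ2.of_le (by norm_num)) hχc hα1'
  choose Z1s Z1h hZ1 using fun l' =>
    exists_bound_holderWith_of_hasCompactSupport (hDχ l').1 (hDχ l').2 hα1'
  choose Z2s Z2h hZ2 using fun i j =>
    exists_bound_holderWith_of_hasCompactSupport (hD2χ i j).1 (hD2χ i j).2 hα1'
  -- one constant `Z` for all of them
  obtain ⟨Z, hZ0s, hZ0h, hZ1le, hZ2le⟩ : ∃ Z : ℝ≥0, Z0s ≤ Z ∧ Z0h ≤ Z ∧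
      (∀ l', Z1s l' ≤ Z ∧ Z1h l' ≤ Z) ∧ ∀ i j, Z2s i j ≤ Z ∧ Z2h i j ≤ Z := by
    refine ⟨Z0s + Z0h + (∑ l', (Z1s l' + Z1h l')) + ∑ i, ∑ j, (Z2s i j + Z2h i j),
      (le_self_add.trans le_self_add).trans le_self_add,
      (le_add_self.trans le_self_add).trans le_self_add, fun l' => ?_, fun i j => ?_⟩
    · have h : Z1s l' + Z1h l' ≤ ∑ k, (Z1s k + Z1h k) :=
        Finset.single_le_sum (f := fun k => Z1s k + Z1h k) (fun _ _ => zero_le)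
          (Finset.mem_univ l')
      exact ⟨le_self_add.trans ((h.trans le_add_self).trans le_self_add),
        le_add_self.trans ((h.trans le_add_self).trans le_self_add)⟩
    · have h1 : Z2s i j + Z2h i j ≤ ∑ j', (Z2s i j' + Z2h i j') :=
        Finset.single_le_sum (f := fun j' => Z2s i j' + Z2h i j') (fun _ _ => zero_le)
          (Finset.mem_univ j)
      have h2 : (∑ j', (Z2s i j' + Z2h i j')) ≤ ∑ i', ∑ j', (Z2s i' j' + Z2h i' j') :=
        Finset.single_le_sum (f := fun i' => ∑ j', (Z2s i' j' + Z2h i' j')) (fun _ _ => zero_le)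
          (Finset.mem_univ i)
      exact ⟨le_self_add.trans ((h1.trans h2).trans le_add_self),
        le_add_self.trans ((h1.trans h2).trans le_add_self)⟩
  have hχ0 : ∀ x, ‖χ x‖ ≤ Z := fun x => (hZ0.1 x).trans (NNReal.coe_le_coe.2 hZ0s)
  have hχH : HolderWith Z α χ := hZ0.2.mono hZ0h
  have hDχ0 : ∀ l' x, ‖fderiv ℝ χ x (bE l')‖ ≤ Z := fun l' x =>
    ((hZ1 l').1 x).trans (NNReal.coe_le_coe.2 (hZ1le l').1)
  have hDχH : ∀ l', HolderWith Z α (fun x => fderiv ℝ χ x (bE l')) := fun l' =>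
    (hZ1 l').2.mono (hZ1le l').2
  have hD2χ0 : ∀ i j x, ‖iteratedFDeriv ℝ 2 χ x ![bE i, bE j]‖ ≤ Z := fun i j x =>
    ((hZ2 i j).1 x).trans (NNReal.coe_le_coe.2 (hZ2le i j).1)
  have hD2χH : ∀ i j, HolderWith Z α (fun x => iteratedFDeriv ℝ 2 χ x ![bE i, bE j]) :=
    fun i j => (hZ2 i j).2.mono (hZ2le i j).2
  -- vanishing of `χ`, `∂χ`, `∂²χ` off the big ball
  have hzχ : ∀ x ∉ ball x₀ R, χ x = 0 := fun x hx =>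
    image_eq_zero_of_notMem_tsupport fun h => hx (hχR h)
  have hzDχ : ∀ l', ∀ x ∉ ball x₀ R, fderiv ℝ χ x (bE l') = 0 := fun l' x hx => by
    rw [fderiv_of_notMem_tsupport ℝ fun h => hx (hχR h)]; rfl
  have hzD2χ : ∀ i j, ∀ x ∉ ball x₀ R, iteratedFDeriv ℝ 2 χ x ![bE i, bE j] = 0 :=
    fun i j x hx => by
      have : x ∉ tsupport (iteratedFDeriv ℝ 2 χ) := fun h =>
        hx (hχR (tsupport_iteratedFDeriv_subset 2 h))
      rw [image_eq_zero_of_notMem_tsupport this]; rfl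
  -- Step 3: the compact-support estimate on `K = B̄_{r₂}` with radius `ρe < R - r₂`
  obtain ⟨ρe, hρe, hρeR⟩ := exists_between (sub_pos.2 hr₂R)
  have hKball : ∀ y ∈ closedBall x₀ r₂, ball y ρe ⊆ ball x₀ R := fun y hy x hx => by
    rw [mem_ball] at hx ⊢
    have hy' := mem_closedBall.1 hy
    calc dist x x₀ ≤ dist x y + dist y x₀ := dist_triangle _ _ _
      _ < ρe + r₂ := add_lt_add_of_lt_of_le hx hy'
      _ < R := by linarith
  obtain ⟨C₀, hC₀⟩ := exists_schauder_compact_support bE hα0 hα1 hl L Ka 0 0 hK hρe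
  -- Step 4: the constant
  obtain ⟨Q, hQ⟩ : ∃ Q : ℝ≥0, Q = Z * (16 + 14 * (Fintype.card ι : ℝ≥0) ^ 2 * Ka) := ⟨_, rfl⟩
  obtain ⟨M, hM⟩ : ∃ M : ℝ≥0, (M : ℝ) = (2 * R) ^ (α : ℝ) :=
    ⟨⟨(2 * R) ^ (α : ℝ), by positivity⟩, rfl⟩
  refine ⟨(Fintype.card ι : ℝ≥0) ^ 2 * C₀ * Q * (1 + M), ?_⟩
  intro a hsymm hlow hup ha0 haH v f B H hv hD2vH hPDE hf0 hfH hv0 hDv hDvH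
  -- Step 5: the cut-off product `u = χ v` (globally `C²`, compact support in `K`)
  have hu_s : ContDiff ℝ 2 (fun y => χ y * v y) :=
    contDiff_mul_of_tsupport_subset hχ2 isOpen_ball hv hχR
  obtain ⟨hu_c, hu_supp⟩ := hasCompactSupport_and_tsupport_mul_subset v hK hχK
  obtain ⟨hE1, hE2⟩ :=
    fderiv_cutoff_mul_eq_and_iteratedFDeriv_two_cutoff_mul_eq_of_contDiffOn_two hχ isOpen_ball
      hv hK hKR hχK
  set u : E → ℝ := fun y => χ y * v y with hu
  -- Step 6: the data of `v` on the big ball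
  have hvd : ∀ z ∈ ball x₀ R, DifferentiableAt ℝ v z := fun z hz =>
    (hv.contDiffAt (isOpen_ball.mem_nhds hz)).differentiableAt (by simp)
  have hvH : HolderOnWith (B + 2 * B) α v (ball x₀ R) :=
    holderOnWith_of_norm_fderiv_le (convex_ball x₀ R) hα1' hvd hDv hv0
  have hDv0 : ∀ l', ∀ x ∈ ball x₀ R, ‖fderiv ℝ v x (bE l')‖ ≤ B := fun l' x hx => by
    have h := (fderiv ℝ v x).le_of_opNorm_le_of_le (hDv x hx) (bE.norm_eq_one l').le
    rwa [mul_one] at h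
  have hDvH' : ∀ l', HolderOnWith B α (fun x => fderiv ℝ v x (bE l')) (ball x₀ R) := fun l' =>
    holderOnWith_clm_apply hDvH (bE.norm_eq_one l').le
  -- the second derivative of `v` on the big ball: bounded (qualitatively) and entrywise Hölder
  obtain ⟨Gs, hGs⟩ : ∃ Gs : ℝ≥0, ∀ x ∈ ball x₀ R, ‖iteratedFDeriv ℝ 2 v x‖ ≤ Gs := by
    refine ⟨⟨‖iteratedFDeriv ℝ 2 v x₀‖ + H * R ^ (α : ℝ), by positivity⟩, fun x hx => ?_⟩
    have h1 : dist (iteratedFDeriv ℝ 2 v x) (iteratedFDeriv ℝ 2 v x₀) ≤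
        H * dist x x₀ ^ (α : ℝ) := hD2vH.dist_le hx (mem_ball_self hR)
    have h2 : dist x x₀ ^ (α : ℝ) ≤ R ^ (α : ℝ) :=
      Real.rpow_le_rpow dist_nonneg (mem_ball.1 hx).le α.coe_nonneg
    show ‖iteratedFDeriv ℝ 2 v x‖ ≤ ‖iteratedFDeriv ℝ 2 v x₀‖ + H * R ^ (α : ℝ)
    calc ‖iteratedFDeriv ℝ 2 v x‖
        ≤ ‖iteratedFDeriv ℝ 2 v x₀‖ + ‖iteratedFDeriv ℝ 2 v x - iteratedFDeriv ℝ 2 v x₀‖ :=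
          norm_le_norm_add_norm_sub' _ _
      _ ≤ ‖iteratedFDeriv ℝ 2 v x₀‖ + H * R ^ (α : ℝ) := by
          rw [← dist_eq_norm]
          exact add_le_add le_rfl (h1.trans (mul_le_mul_of_nonneg_left h2 H.coe_nonneg))
  have hD2ve : ∀ i j, ∀ x ∈ ball x₀ R, ‖iteratedFDeriv ℝ 2 v x ![bE i, bE j]‖ ≤ Gs :=
    fun i j x hx => by
      refine ((iteratedFDeriv ℝ 2 v x).le_of_opNorm_le (hGs x hx) _).trans (le_of_eq ?_)
      rw [Fin.prod_univ_two]
      simp only [Matrix.cons_val_zero, Matrix.cons_val_one, bE.norm_eq_one, mul_one]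
  have hD2vHe : ∀ i j, HolderOnWith H α (fun x => iteratedFDeriv ℝ 2 v x ![bE i, bE j])
      (ball x₀ R) := fun i j =>
    holderOnWith_apply_vecCons_two hD2vH (bE.norm_eq_one i).le (bE.norm_eq_one j).le
  -- Step 7: the inputs of the compact-support estimate, all bounded by multiples of `B`
  have hu' : u = fun x => v x * χ x := by rw [hu]; funext x; exact mul_comm _ _
  have hUh : HolderWith (B * Z + (B + 2 * B) * Z) α u := by
    rw [hu']
    exact holderWith_mul_of_eq_zero (s := ball x₀ R) hv0 hvH hχH hχ0 hzχ
  have hUs : ∀ x, ‖u x‖ ≤ ((B * Z : ℝ≥0) : ℝ) := fun x => by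
    rw [hu', NNReal.coe_mul]
    exact norm_mul_le_of_eq_zero hv0 hχ0 hzχ x
  have hD1h : ∀ l', HolderWith ((B * Z + B * Z) + (B * Z + (B + 2 * B) * Z)) α
      (fun x => fderiv ℝ u x (bE l')) := fun l' => by
    have heq : (fun x => fderiv ℝ u x (bE l')) =
        fun x => fderiv ℝ v x (bE l') * χ x + v x * fderiv ℝ χ x (bE l') :=
      funext fun x => hE1 x (bE l')
    rw [heq]
    exact (holderWith_mul_of_eq_zero (s := ball x₀ R) (hDv0 l') (hDvH' l') hχH hχ0 hzχ).add
      (holderWith_mul_of_eq_zero (s := ball x₀ R) hv0 hvH (hDχH l') (hDχ0 l') (hzDχ l'))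
  have hD1s : ∀ l' x, ‖fderiv ℝ u x (bE l')‖ ≤ ((B * Z + B * Z : ℝ≥0) : ℝ) := fun l' x => by
    rw [hE1 x (bE l'), NNReal.coe_add, NNReal.coe_mul]
    exact (norm_add_le _ _).trans (add_le_add (norm_mul_le_of_eq_zero (hDv0 l') hχ0 hzχ x)
      (norm_mul_le_of_eq_zero hv0 (hDχ0 l') (hzDχ l') x))
  -- the perturbation terms `g i j = ∂ⱼv ∂ᵢχ + ∂ᵢv ∂ⱼχ + v ∂ᵢⱼχ`
  obtain ⟨g, hg⟩ : ∃ g : ι → ι → E → ℝ, ∀ i j, g i j = fun x =>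
      fderiv ℝ v x (bE j) * fderiv ℝ χ x (bE i) + fderiv ℝ v x (bE i) * fderiv ℝ χ x (bE j) +
        v x * iteratedFDeriv ℝ 2 χ x ![bE i, bE j] := ⟨_, fun _ _ => rfl⟩
  obtain ⟨Hh, hHh⟩ : ∃ Hh : ℝ≥0,
      Hh = (B * Z + B * Z) + (B * Z + B * Z) + (B * Z + (B + 2 * B) * Z) := ⟨_, rfl⟩
  obtain ⟨Hs, hHs⟩ : ∃ Hs : ℝ≥0, Hs = B * Z + B * Z + B * Z := ⟨_, rfl⟩
  have hgH : ∀ i j, HolderWith Hh α (g i j) := fun i j => by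
    rw [hg i j, hHh]
    exact ((holderWith_mul_of_eq_zero (s := ball x₀ R) (hDv0 j) (hDvH' j) (hDχH i) (hDχ0 i)
      (hzDχ i)).add (holderWith_mul_of_eq_zero (s := ball x₀ R) (hDv0 i) (hDvH' i) (hDχH j)
      (hDχ0 j) (hzDχ j))).add
      (holderWith_mul_of_eq_zero (s := ball x₀ R) hv0 hvH (hD2χH i j) (hD2χ0 i j) (hzD2χ i j))
  have hgs : ∀ i j x, ‖g i j x‖ ≤ (Hs : ℝ) := fun i j x => by
    rw [hg i j, hHs, NNReal.coe_add, NNReal.coe_add, NNReal.coe_mul]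
    exact (norm_add_le _ _).trans (add_le_add ((norm_add_le _ _).trans (add_le_add
      (norm_mul_le_of_eq_zero (hDv0 j) (hDχ0 i) (hzDχ i) x)
      (norm_mul_le_of_eq_zero (hDv0 i) (hDχ0 j) (hzDχ j) x)))
      (norm_mul_le_of_eq_zero hv0 (hD2χ0 i j) (hzD2χ i j) x))
  have hgz : ∀ i j, ∀ x ∉ ball x₀ R, g i j x = 0 := fun i j x hx => by
    rw [hg i j]
    dsimp only
    rw [hzDχ i x hx, hzDχ j x hx, hzD2χ i j x hx]
    ring
  have hT1 : ∀ i j, HolderWith (Ka * Hh + Ka * Hs) α (fun x => a i j x * g i j x) := fun i j =>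
    holderWith_mul_of_eq_zero (s := ball x₀ R) (ha0 i j) (haH i j) (hgH i j) (hgs i j) (hgz i j)
  have hT1s : ∀ i j x, ‖a i j x * g i j x‖ ≤ ((Ka * Hs : ℝ≥0) : ℝ) := fun i j x => by
    rw [NNReal.coe_mul]
    exact norm_mul_le_of_eq_zero (ha0 i j) (hgs i j) (hgz i j) x
  have hT0 : HolderWith (B * Z + B * Z) α (fun x => f x * χ x) :=
    holderWith_mul_of_eq_zero (s := ball x₀ R) hf0 hfH hχH hχ0 hzχ
  have hT0s : ∀ x, ‖f x * χ x‖ ≤ ((B * Z : ℝ≥0) : ℝ) := fun x => by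
    rw [NNReal.coe_mul]
    exact norm_mul_le_of_eq_zero hf0 hχ0 hzχ x
  -- `P u = χ f + ∑ aⁱʲ gᵢⱼ`
  have hPeq : ∀ x, (∑ i, ∑ j, a i j x * iteratedFDeriv ℝ 2 u x ![bE i, bE j]) =
      f x * χ x + ∑ i, ∑ j, a i j x * g i j x := by
    intro x
    have h1 : (∑ i, ∑ j, a i j x * iteratedFDeriv ℝ 2 u x ![bE i, bE j]) =
        (∑ i, ∑ j, a i j x * iteratedFDeriv ℝ 2 v x ![bE i, bE j]) * χ x +
          ∑ i, ∑ j, a i j x * g i j x := by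
      rw [Finset.sum_mul, ← Finset.sum_add_distrib]
      refine Finset.sum_congr rfl fun i _ => ?_
      rw [Finset.sum_mul, ← Finset.sum_add_distrib]
      refine Finset.sum_congr rfl fun j _ => ?_
      rw [hE2 x (bE i) (bE j), hg i j]
      ring
    rw [h1]
    by_cases hx : x ∈ ball x₀ R
    · rw [hPDE x hx]
    · rw [hzχ x hx, mul_zero, mul_zero]
  have hP : HolderWith ((B * Z + B * Z) + ∑ _i : ι, ∑ _j : ι, (Ka * Hh + Ka * Hs)) α
      (fun x => (∑ i, ∑ j, a i j x * iteratedFDeriv ℝ 2 u x ![bE i, bE j]) +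
        (∑ l', (0 : ℝ) * fderiv ℝ u x (bE l')) + (0 : ℝ) * u x) := by
    have heq : (fun x => (∑ i, ∑ j, a i j x * iteratedFDeriv ℝ 2 u x ![bE i, bE j]) +
        (∑ l', (0 : ℝ) * fderiv ℝ u x (bE l')) + (0 : ℝ) * u x) =
        fun x => f x * χ x + ∑ i, ∑ j, a i j x * g i j x := by
      funext x
      rw [hPeq x]
      simp
    rw [heq]
    exact hT0.add (holderWith_finset_sum (f := fun i x => ∑ j, a i j x * g i j x) Finset.univ
      fun i _ => holderWith_finset_sum (f := fun j x => a i j x * g i j x) Finset.univ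
        fun j _ => hT1 i j)
  have hPs : ∀ x, ‖(∑ i, ∑ j, a i j x * iteratedFDeriv ℝ 2 u x ![bE i, bE j]) +
      (∑ l', (0 : ℝ) * fderiv ℝ u x (bE l')) + (0 : ℝ) * u x‖ ≤
      ((B * Z + ∑ _i : ι, ∑ _j : ι, Ka * Hs : ℝ≥0) : ℝ) := fun x => by
    rw [hPeq x]
    simp only [zero_mul, Finset.sum_const_zero, add_zero, NNReal.coe_add, NNReal.coe_sum]
    exact (norm_add_le _ _).trans (add_le_add (hT0s x) ((norm_sum_le _ _).trans
      (Finset.sum_le_sum fun i _ => (norm_sum_le _ _).trans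
        (Finset.sum_le_sum fun j _ => hT1s i j x))))
  -- Step 8: `u ∈ C^{2,α}_b` — `C²` with compact support, and `D²u` is globally `α`-Hölder by
  -- the Leibniz formula (here the Hölder hypothesis on `D²v` is used, qualitatively only)
  have hentH : ∀ i j, HolderWith (Gs * Z + H * Z + Hh) α
      (fun x => iteratedFDeriv ℝ 2 u x ![bE i, bE j]) := fun i j => by
    have heq : (fun x => iteratedFDeriv ℝ 2 u x ![bE i, bE j]) =
        fun x => iteratedFDeriv ℝ 2 v x ![bE i, bE j] * χ x + g i j x := by
      funext x
      rw [hE2 x (bE i) (bE j), hg i j]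
    rw [heq]
    exact (holderWith_mul_of_eq_zero (s := ball x₀ R) (hD2ve i j) (hD2vHe i j) hχH hχ0 hzχ).add
      (hgH i j)
  have hu2 : MemContDiffHolder 2 α u := by
    refine ⟨hu_s, fun j hj => ?_,
      (holderWith_iteratedFDeriv_two_of_entries bE u hentH).memHolder⟩
    have hcont : Continuous (iteratedFDeriv ℝ j u) :=
      hu_s.continuous_iteratedFDeriv (by exact_mod_cast hj)
    obtain ⟨C, hC⟩ := hcont.bounded_above_of_compact_support (hu_c.iteratedFDeriv j)
    exact eSupNorm_lt_top_iff.2 ⟨C, hC⟩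
  -- Step 9: the compact-support estimate for `u`
  have key := hC₀ a (fun _ _ => 0) (fun _ => 0) hsymm
    (fun y hy x hx => hlow x (hKball y hy hx)) (fun y hy x hx => hup x (hKball y hy hx))
    (fun y hy i j x hx => ha0 i j x (hKball y hy hx)) (fun y hy i j => (haH i j).mono (hKball y hy))
    (fun _ _ _ _ _ => by simp) (fun _ _ _ _ _ _ _ => by simp) (fun _ _ _ _ => by simp)
    (fun _ _ _ _ _ _ => by simp) u hu2 hu_supp _ _ _ _ _ _ hP hPs hD1s hD1h hUs hUh
  have key' : ∀ p q, HolderWith (C₀ * Q * B) α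
      (fun x => iteratedFDeriv ℝ 2 u x ![bE p, bE q]) := fun p q =>
    (key p q).mono (le_of_eq (by
      simp only [hHh, hHs, hQ, Finset.sum_const, Finset.card_univ, nsmul_eq_mul]
      ring))
  -- Step 10: consequences for `D²u`: global Hölder bound and sup bound
  have hHu : HolderWith ((Fintype.card ι : ℝ≥0) ^ 2 * (C₀ * Q * B)) α (iteratedFDeriv ℝ 2 u) :=
    holderWith_iteratedFDeriv_two_of_entries bE u key'
  have hzu : ∀ p q, ∀ x ∉ ball x₀ R, iteratedFDeriv ℝ 2 u x ![bE p, bE q] = 0 :=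
    fun p q x hx => by
      have : x ∉ tsupport (iteratedFDeriv ℝ 2 u) := fun h =>
        hx (hKR (hu_supp (tsupport_iteratedFDeriv_subset 2 h)))
      rw [image_eq_zero_of_notMem_tsupport this]; rfl
  have hsup : ∀ x, ‖iteratedFDeriv ℝ 2 u x‖ ≤
      (Fintype.card ι : ℝ) ^ 2 * ((C₀ * Q * B : ℝ≥0) * (2 * R) ^ (α : ℝ)) := fun x =>
    norm_iteratedFDeriv_two_le_of_apply_le bE u x (by positivity)
      fun p q => norm_le_of_holderWith_of_eq_zero (key' p q) hR (hzu p q) x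
  -- Step 11: `u = v` near every point of the small ball
  have hD2eq : ∀ x ∈ ball x₀ ρ, iteratedFDeriv ℝ 2 v x = iteratedFDeriv ℝ 2 u x := fun x hx => by
    have hxK : x ∈ closedBall x₀ r₁ := mem_closedBall.2 ((mem_ball.1 hx).trans hρr₁).le
    have hev : u =ᶠ[𝓝 x] v := by
      filter_upwards [hχ1.filter_mono (nhds_le_nhdsSet hxK)] with y hy
      simp only [hu, hy, one_mul]
    exact ((hev.iteratedFDeriv ℝ 2).eq_of_nhds).symm
  refine ⟨fun x hx => ?_, ?_⟩
  · rw [hD2eq x hx]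
    refine (hsup x).trans ?_
    rw [← hM]
    push_cast
    have h0 : (0 : ℝ) ≤ (Fintype.card ι : ℝ) ^ 2 * C₀ * Q * B := by positivity
    nlinarith [h0, M.coe_nonneg]
  · intro x hx y hy
    rw [hD2eq x hx, hD2eq y hy]
    refine (hHu.mono ?_) x y
    calc (Fintype.card ι : ℝ≥0) ^ 2 * (C₀ * Q * B)
        = (Fintype.card ι : ℝ≥0) ^ 2 * C₀ * Q * 1 * B := by ring
      _ ≤ (Fintype.card ι : ℝ≥0) ^ 2 * C₀ * Q * (1 + M) * B := by gcongr; exact le_self_add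

end Literature.Analysis.PDE
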